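import Summits.CriticalPhenomena.Ising3DConformalLimit.Theses.CoerciveSharpness
import Summits.CriticalPhenomena.Ising3DConformalLimit.Theorems.CoerciveSharpnessPhiCoerciveSplit
import Summits.CriticalPhenomena.Ising3DConformalLimit.Theorems.PhiCoercive.Negative.PhiCoerciveLoadBearing
import Summits.CriticalPhenomena.Ising3DConformalLimit.Theorems.PhiCoercive.Negative.PhiCoerciveGaussianSaturation

/-!
# Disproof of `PhiCoercive` (stmt-CriticalPhenomena-18196) — findings of the crux disprover

Crux (route `CoerciveSharpness`, rank 2; `phiC S = dcpPhi 3 (criticalBeta 3) S` by `rfl`):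

  `PhiCoercive := ∃ κ c : ℝ, 0 < κ ∧ 0 < c ∧ ∀ m ≥ 1, ∀ finite S ⊇ Λ_m, c·m^κ ≤ φ_{β_c(3)}(S)`,
  `φ_β(S) = β Σ_{x ∈ S} #{y ∉ S : y ∼ x} ⟨σ₀σ_x⟩^free_{S,β}` (Duminil-Copin–Panis 2025, Def. 1.1).

**VERDICT (cycle 1): no kill; the crux RESISTS.**  It is an open-problem-level GROWTH statement whose `κ = 0`
shadow is a theorem (`BoxSuperset.one_le_phiC`), whose box half is the surface-exponent inequality
`κ_box = 1 − η_⊥ = d − 1 − Δ_σ − Δ̂_σ ≈ 0.21 > 0` on `ℤ³` (measured `0.194 ± 0.002`, refuter job j022942), and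
whose superset half (`BoxSuperset.SupersetStable`) no analysed family depresses.  A Lean refutation would need a
rigorous `o(m^κ)`-for-every-`κ` UPPER bound on `φ_{β_c(3)}(S_m)` along some superset family — but every rigorous
upper bound is `φ(Λ_m) ≤ A·m` (`Negative.phiC_box_le_linear`) and physically `φ` grows.  What this file records,
as Lean (landed companions: `Theorems/PhiCoercive/Negative/PhiCoerciveLoadBearing.lean` = p161130,
`…/PhiCoerciveGaussianSaturation.lean` = p161347, both sorry-free, axioms propext/choice/Quot.sound):

## Index
* §(a) LOAD-BEARING ANALYSIS — every hypothesis of the crux dropped/weakened in turn: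
  - anchor `Λ_m ⊆ S` ↦ `0 ∈ S`: FALSE (`phiCoercive_false_without_box`, witness `S = {0}`, `φ({0}) = 6β_c`);
  - criticality `β = β_c(3)` ↦ `β < β_c(3)`: FALSE (`phiCoercive_false_without_criticality`, `φ_β(Λ_m) → 0`);
  - growth `κ > 0` ↦ `κ = 0`: TRUE, a theorem (`phiCoerciveWithoutGrowth_holds`) — only growth is content;
  - interaction (Ising ↦ Gaussian walk at its critical point): FALSE with EQUALITY `φ^G ≡ 1`
    (`gaussPhi_eq_one`, `phiCoercive_false_gaussian`) — any proof must use a non-Gaussian input;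
  - dimension `d = 3` ↦ `d ≥ 5`: physically FALSE (`κ = 0`, mean-field boundary flux), NOT provable today (§(e)).
* §(b) TIGHTNESS — `phiC_box_le_linear`: `1 ≤ φ(Λ_m) ≤ A m`; the exponent gap ledger `κ ∈ (0, 1]`.
* §(c) NATURAL STRENGTHENINGS REFUTED — `κ > 1` (`not_phiCoerciveExponentGtOne`); the negation shapes
  (`not_phiCoercive_iff`, `supersetDepression_imp_not_phiCoercive`) = what a counterexample family must do.
* §(d) TARGETS — registered stubs `stub_boxCoercive : BoxCoercive` (open-problem; exponent ≤ 1 proved here),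
  `stub_supersetStable : SupersetStable` (not broken; `supersetStable_of_phiMonotone` shows the one cheap route,
  monotonicity of `φ` in `S`, would suffice — its truth is being measured, §(e)); no `stuck_stubs` were handed over.
* §(e) NEAR-MISSES / NUMERICS — superset scan (2-D exact transfer matrix, kit job j026091: 293 supersets of
  `Λ_2, Λ_3, Λ_4` in 17 families at `β_c(ℤ²)`): **no superset radiates less than its box** (min ratio 1.000, only at
  `S = Λ_m`; porous/caged/diluted coats +2…80 %; confirmed by j026052, 312 more); 3-D EXACT tube scan j026145:
  `φ(Λ_1) = 1.520778`, `φ(Λ_2) = 1.654091`, all 28 supersets above their box, domain-monotonicity false by `3·10⁻⁴`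
  (pit instance) but never "superset below box"; `d ≥ 5` failure (no tool).

## Why it resists (for the provers)
1. No finite falsifier exists by shape: any finite range of `m` holds with some `κ > 0` because `φ ≥ 1`
   (refuter `phiCoercive_bounded_range`, item notes); only `m → ∞` asymptotics carry content, and `β_c(3)`,
   `⟨σ₀σ_x⟩_{β_c(3)}` have no closed form — nothing is decidable/`norm_num`-able.
2. BOX half: three independent determinations of `Δ̂_σ` (MC 1.2751(6), bootstrap ≈ 1.276, ε-expansion) put
   `κ_box ≈ 0.207` with margin ≫ errors; direct fit `κ = 0.194(2)` (j022942); `d = 2` exact `→ 3/8`, `d = 5` flat —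
   exactly the surface-scaling dictionary.  A refutation of `BoxCoercive` would be a refutation of the ordinary
   surface universality class of the 3-D Ising model.
3. SUPERSET half: flux can leave only through `∂S`; `phiC_ge_inner` (GKS) re-exposes any uncovered fraction of a
   shell; holes near `Λ_m` see BULK correlations (`≍ r^{-1.04}`) which exceed face correlations (`≍ r^{-1.79}`), so
   perforation/porosity RAISES flux; full coverings push the boundary outward where boxes radiate MORE (`κ > 0`);
   convex smoothing (corner screening, Cardy wedge exponents) changes constants only.  The 2-D exact scans (§(e):
   605 supersets, none below its box) quantify it.  CONTINUUM PICTURE (d = 2, heuristic, explains the numbers): for a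
   domain `D ∋ 0` and `S = mD ∩ ℤ²`, `φ(S) ≈ m^{3/8}·A(D)` with, by bulk–boundary conformal covariance of
   `⟨σ(0)σ̂(x)⟩_D` (`Δ_σ = 1/8`, free-boundary spin `σ̂` of dimension `Δ̂ = 1/2`) and up to a lattice-orientation
   factor of order one, `A(D) ∝ r_D^{-1/8}·∫_{∂D}|g_D'|^{1/2}|dx| = r_D^{-1/8}·2π·𝐄_{ω_D}[|g_D'|^{-1/2}]` (`g_D : D → 𝔻`,
   `g_D(0) = 0`, `r_D` = conformal radius, `ω_D` = harmonic measure from 0).  (i) Disc of radius `ρ`: `A = ρ^{3/8}`;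
   unit square (Schwarz–Christoffel, `r = 1.0787`, `𝐄_ω|g'|^{-1/2} = 1.0719`): `A_□ = 1.0618` versus its circumscribed
   disc `A_○ = 2^{3/16} = 1.1388` — predicted ratio `1.072`, measured `1.072 (m=3), 1.065 (m=4)`.  (ii) Hadamard
   variation about the disc: pushing `∂𝔻_ρ` outward by `δn(θ) ≥ 0` changes `A` at first order by `+(3/8)(⟨δn⟩/ρ)·A`
   (each Fourier mode of `δn` has zero first variation by rotation symmetry, only the mean survives) — smooth supersets
   of a disc radiate MORE; about the square the sign of the shape gradient is what the scans measure (bumps, rect,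
   rounded boxes: all `> 1`), and lattice-scale roughness, outside any expansion, gives `+7…80 %`.  (iii) No collapse over wild supersets either:
   `𝐄_ω[|g'|^{-1/2}] ≥ 1/𝐄_ω[|g'|^{1/2}]` (Cauchy–Schwarz) and Beurling's estimate `ω(E) ≲ Λ₁(E)^{1/2}` for boundary
   arcs at distance `≥ 1` keep `∫|g'|^{3/2}` bounded, while screening `0` by inward needles forces `r_D = O(1)`: so
   `inf_{D ⊇ □} A(D) ≍ A_□`.  The same structure (first variation `= +κ·⟨δn⟩·A`, `κ ≈ 0.21`) is expected on `ℤ³`.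
4. Every rigorous inequality available at `β_c(3)` (GKS, GHS, Simon–Lieb, MMS, IRB, switching, DC–Panis) is an
   equality or is saturated for the Gaussian walk, where `φ ≡ 1` (`gaussPhi_eq_one`): so the disprover cannot get
   an `O(1)` upper bound from them either — the same wall the provers face from below.
-/

noncomputable section

namespace Summit.CriticalPhenomena.Ising3DConformalLimit.Cruxes.PhiCoercive.Disproof

open scoped BigOperators Topology
open Finset Filter
open Literature.Probability.LatticeModels
open Summit.CriticalPhenomena.Ising3DConformalLimit.Theses.CoerciveSharpness (PhiCoercive)
open Summit.CriticalPhenomena.Ising3DConformalLimit.Cruxes.PhiCoercive.BoxSuperset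
open Summit.CriticalPhenomena.Ising3DConformalLimit.Cruxes.PhiCoercive.Negative

/-! ## (a) Load-bearing analysis -/

/-- The crux at inverse temperature `β` (same `φ`, `= dcpPhi 3 β`; the crux is `β = β_c(3)`). -/
def PhiCoerciveAt (β : ℝ) : Prop :=
  ∃ κ c : ℝ, 0 < κ ∧ 0 < c ∧ ∀ m : ℕ, 1 ≤ m → ∀ S : Finset (Site 3), box 3 m ⊆ S →
    c * (m : ℝ) ^ κ ≤ dcpPhi 3 β S

/-- `PhiCoerciveAt (β_c(3))` IS the crux (definitionally). -/
theorem phiCoerciveAt_criticalBeta_iff : PhiCoerciveAt (criticalBeta 3) ↔ PhiCoercive := Iff.rfl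

/-- **H = criticality is load-bearing**: for `0 ≤ β < β_c(3)` the crux's statement is FALSE
(`φ_β(Λ_{k+1}) ≤ 6β·54(k+1)²e^{-c(k+1)} → 0`, Aizenman–Barsky–Fernández sharpness; landed
`Negative.phiCoercive_false_subcritical`).  Consequence for provers: no input that is continuous or monotone
in `β ↑ β_c` from the subcritical side can yield the growth; the mechanism must live AT `β_c` (e.g. `L(β_c) = ∞`,
`χ(β_c) = ∞`, `B(β_c) = ∞` — but see (a.4): those are Gaussian-saturated). -/
theorem phiCoercive_false_without_criticality {β : ℝ} (hβ : 0 ≤ β) (hβc : β < criticalBeta 3) :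
    ¬ PhiCoerciveAt β :=
  phiCoercive_false_subcritical hβ hβc

/-- The crux with the anchor `Λ_m ⊆ S` weakened to the Duminil-Copin–Tassion indexing `0 ∈ S`. -/
def PhiCoerciveWithoutBox : Prop :=
  ∃ κ c : ℝ, 0 < κ ∧ 0 < c ∧ ∀ m : ℕ, 1 ≤ m → ∀ S : Finset (Site 3), (0 : Site 3) ∈ S →
    c * (m : ℝ) ^ κ ≤ phiC S

/-- **H = the box anchor is load-bearing**: `¬ PhiCoerciveWithoutBox` (witness `S = {0}` for every `m`:
`φ_{β_c}({0}) = 6β_c(3)`, `Negative.phiC_singleton_zero`).  More generally thin anchored sets radiate `O(1)`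
(a segment of length `2L+1` through `0`: `φ = β_c(4·Σ_j t^{|j|} + 2t^L) ≤ β_c(4(1+t)/(1−t) + 2)`, `t = tanh β_c`,
exactly soluble — not formalised: no tree formula for path graphs), so the anchor cannot be weakened to
"`S ∋ 0` of diameter ≥ m`" either: the route consumes coercivity only on sets CONTAINING a box (the DC–Panis random
current sets `𝒮_n ⊇ Λ_m`), which is the right generality. -/
theorem phiCoercive_false_without_box' : ¬ PhiCoerciveWithoutBox :=
  phiCoercive_false_without_box

/-- The crux with the growth removed (`κ = 0`). -/
def PhiCoerciveWithoutGrowth : Prop :=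
  ∃ c : ℝ, 0 < c ∧ ∀ m : ℕ, 1 ≤ m → ∀ S : Finset (Site 3), box 3 m ⊆ S → c ≤ phiC S

/-- **H = growth is the whole content**: the `κ = 0` shadow is TRUE (`c = 1`, Duminil-Copin–Tassion 2016:
`φ_{β_c}(S) ≥ 1` for every finite `S ∋ 0`; `BoxSuperset.one_le_phiC`).  So there is no `_false_without_growth`. -/
theorem phiCoerciveWithoutGrowth_holds : PhiCoerciveWithoutGrowth :=
  ⟨1, one_pos, fun _ _ _ hS => one_le_phiC (zero_mem_of_box_subset hS)⟩

/-- … and the crux trivially implies its `κ = 0` shadow (`m^κ ≥ 1`). -/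
theorem phiCoercive_imp_withoutGrowth : PhiCoercive → PhiCoerciveWithoutGrowth := by
  rintro ⟨κ, c, hκ, hc, h⟩
  refine ⟨c, hc, fun m hm S hS => le_trans ?_ (h m hm S hS)⟩
  have hpow : (1 : ℝ) ≤ (m : ℝ) ^ κ := Real.one_le_rpow (by exact_mod_cast hm) hκ.le
  nlinarith

/-- The crux with the Ising two-point function replaced by its Gaussian / random-walk value at the Gaussian
critical point (`β⟨σ₀σ_x⟩_S ↦ G_S(0,x) = (−Δ_S)⁻¹(0,x)`, the tree's `dirichletGreen`). -/
def PhiCoerciveGaussian : Prop :=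
  ∃ κ c : ℝ, 0 < κ ∧ 0 < c ∧ ∀ m : ℕ, 1 ≤ m → ∀ S : Finset (Site 3), box 3 m ⊆ S →
    c * (m : ℝ) ^ κ ≤
      ∑ y ∈ S, ((((zdGraph 3).neighborFinset y).filter fun w => w ∉ S).card : ℝ) * dirichletGreen S 0 y

/-- **H = the interaction is load-bearing (Gaussian saturation)**: the Gaussian shadow of the crux is FALSE,
and sharply so — the Gaussian sharpness functional is IDENTICALLY `1` for every finite `S` and base point
(`Negative.gaussPhi_eq_one`: exit-flux conservation of the killed walk).  Any proof of `PhiCoercive` must use an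
input that fails for the Gaussian walk; GKS I/II, GHS, Lebowitz, Simon–Lieb, MMS, the infrared bound, the
switching lemma and bubble divergence (`B(β_c) = ∞` on `ℤ³`, also true for the 3-D GFF) do not qualify.
Barrier-candidate `SharpnessFluxGaussianSaturation` (strategist census §Negation 3), now formal. -/
theorem phiCoercive_false_gaussian : ¬ PhiCoerciveGaussian := by
  rintro ⟨κ, c, hκ, hc, h⟩
  exact not_gaussPhi_coercive hκ hc h

/-! ## (b) Tightness: the exponent-gap ledger for `φ(Λ_m)` is `[0, 1]` -/

/-- **`1 ≤ φ_{β_c}(Λ_m) ≤ A·m`** (`m ≥ 1`): lower = DCT16 (`one_le_phiC`), upper = IRB (`phiC_box_le_linear`).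
Truth `φ(Λ_m) ≍ m^{0.21}`.  Neither end is expected to move with current tools (upper end `o(m)` ⟺ a strict
improvement of the IRB along the free surface; `η > 0` alone would not even suffice since the bound uses bulk
correlations at the surface). -/
theorem phiC_box_window : ∃ A : ℝ, 0 < A ∧ ∀ m : ℕ, 1 ≤ m → 1 ≤ phiC (box 3 m) ∧ phiC (box 3 m) ≤ A * m := by
  obtain ⟨A, hA, h⟩ := phiC_box_le_linear
  exact ⟨A, hA, fun m hm => ⟨one_le_phiC (zero_mem_box 3 m), h m hm⟩⟩

/-- Any witness `(κ, c)` of the crux — indeed of its box half — has `κ ≤ 1`. -/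
theorem exponent_le_one_of_boxWitness {κ c : ℝ} (hc : 0 < c)
    (h : ∀ m : ℕ, 1 ≤ m → c * (m : ℝ) ^ κ ≤ phiC (box 3 m)) : κ ≤ 1 := by
  by_contra hκ
  exact not_boxCoercive_exponent_gt_one (not_le.1 hκ) ⟨c, hc, h⟩

/-! ## (c) Natural strengthenings refuted; the shape of a counterexample -/

/-- The crux with `1 < κ` demanded. -/
def PhiCoerciveExponentGtOne : Prop :=
  ∃ κ c : ℝ, 1 < κ ∧ 0 < c ∧ ∀ m : ℕ, 1 ≤ m → ∀ S : Finset (Site 3), box 3 m ⊆ S →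
    c * (m : ℝ) ^ κ ≤ phiC S

/-- **Strengthening refuted: `κ > 1` is impossible** (`Negative.not_phiCoercive_exponent_gt_one`). -/
theorem not_phiCoerciveExponentGtOne : ¬ PhiCoerciveExponentGtOne :=
  not_phiCoercive_exponent_gt_one

/-- **The negation, unfolded**: `¬ PhiCoercive ↔ ∀ κ > 0, ∀ c > 0, ∃ m ≥ 1, ∃ S ⊇ Λ_m, φ(S) < c·m^κ` — a refuting
object is a superset family along which `φ` is `o(m^κ)` for EVERY `κ > 0` (subpolynomial), infinitely often. -/
theorem not_phiCoercive_iff :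
    ¬ PhiCoercive ↔ ∀ κ c : ℝ, 0 < κ → 0 < c → ∃ m : ℕ, 1 ≤ m ∧ ∃ S : Finset (Site 3),
      box 3 m ⊆ S ∧ phiC S < c * (m : ℝ) ^ κ := by
  rw [phiCoercive_iff]
  push Not
  exact Iff.rfl

/-- A bounded-radiation superset family: `∃ C, ∀ m ≥ 1, ∃ S ⊇ Λ_m, φ_{β_c}(S) ≤ C` — the cleanest kill shape
("sharpness is not coercive"), the thing the 2-D/3-D scans of §(e) look for.  NO candidate is known; every
analysed family stays above `const·φ(Λ_r)` (§ Why it resists, 3). -/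
def SupersetDepression : Prop :=
  ∃ C : ℝ, ∀ m : ℕ, 1 ≤ m → ∃ S : Finset (Site 3), box 3 m ⊆ S ∧ phiC S ≤ C

/-- A bounded family would refute the crux (`c·m^κ → ∞`). Recorded so that a future numerical candidate has its
Lean endgame ready: it remains to BOUND `φ(S_m)` rigorously, which for a porous/caged family needs subcritical-medium
estimates at `β_c(ℤ³)` inside the coat (feasible in principle: a coat that is a subgraph of a lattice with strictly
larger critical `β` decays exponentially by sharpness ON THAT GRAPH — but the re-exposed inner shell then radiates
`≳ φ(Λ_m)` by `phiC_ge_inner`, which is why no such family works). -/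
theorem supersetDepression_imp_not_phiCoercive : SupersetDepression → ¬ PhiCoercive := by
  rintro ⟨C, hC⟩ ⟨κ, c, hκ, hc, h⟩
  have ht : Tendsto (fun m : ℕ => c * (m : ℝ) ^ κ) atTop atTop :=
    ((tendsto_rpow_atTop hκ).comp tendsto_natCast_atTop_atTop).const_mul_atTop hc
  obtain ⟨m, hm1, hm2⟩ := ((ht.eventually_gt_atTop C).and (eventually_ge_atTop 1)).exists
  obtain ⟨S, hS, hφ⟩ := hC m hm2
  have h2 : c * (m : ℝ) ^ κ ≤ phiC S := h m hm2 S hS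
  linarith

/-! ## (d) Targets: the registered stubs of line `box-superset` -/

/-- `stub_boxCoercive : BoxCoercive` — NOT broken (open-problem; physically true).  What is proved about it:
its exponent is `≤ 1` (`exponent_le_one_of_boxWitness`), its `κ = 0` shadow holds
(`BoxSuperset.boxCoercive_kappa_zero`), its subcritical and Gaussian shadows fail (§(a)). -/
theorem boxCoercive_exponent_le_one : BoxCoercive → ∃ κ c : ℝ, 0 < κ ∧ κ ≤ 1 ∧ 0 < c ∧
    ∀ m : ℕ, 1 ≤ m → c * (m : ℝ) ^ κ ≤ phiC (box 3 m) := by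
  rintro ⟨κ, c, hκ, hc, h⟩
  exact ⟨κ, c, hκ, exponent_le_one_of_boxWitness hc h, hc, h⟩

/-- Monotonicity of `φ_{β_c}` in the domain among sets containing the origin.  NUMERICALLY FALSE (§(e.3), exact):
`φ(Λ_2 ∖ {(2,0,0)}) = 1.654539 > φ(Λ_2) = 1.654091` on `ℤ³` at `β = 0.2216546` — a face-centre pit radiates `0.03 %`
more than the full box.  But the failure is tiny and one-directional: in 633 exact 2-D/3-D instances no SUPERSET of a
box radiates less than the box; one-site decorations multiply a face term by `5t ≈ 1.09`, and concave-corner fills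
(`q = 2, 3, 5`), whose first-order count `(6−q)t < 1` suggests a decrease, in fact INCREASE `φ` through GKS feedback
(ratios 1.0053 → 1.0069 → 1.0072; pit 1.0109 → filled 1.0113).  So this cheap route to `SupersetStable` is formally
dead (no Lean instance: `β_c(3)` has no closed form), while its conclusion with `c' = 1, r = m` ("BoxMinimal") is what
the data show. -/
def PhiMonotone : Prop :=
  ∀ S T : Finset (Site 3), (0 : Site 3) ∈ S → S ⊆ T → phiC S ≤ phiC T

/-- `stub_supersetStable : SupersetStable` — NOT broken.  The one cheap route: domain-monotonicity of `φ` would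
give it with `c' = 1`, `r = m`.  (So an instance of NON-monotonicity is worth recording: it closes this route.) -/
theorem supersetStable_of_phiMonotone (hmono : PhiMonotone) : SupersetStable :=
  ⟨1, one_pos, fun m _ S hS => ⟨m, le_rfl, by rw [one_mul]; exact hmono _ _ (zero_mem_box 3 m) hS⟩⟩

/-! ## (e) Near-misses and numerics

### (e.1) `d ≥ 5`: the crux's dimension is load-bearing — physically clear, formally out of reach
`def PhiCoerciveDim d` below is the crux in dimension `d`.  For `d ≥ 5` (and for the Gaussian walk in every `d`)
`φ_{β_c(d)}(Λ_m) = O(1)` is the mean-field surface law (`Δ_σ + Δ̂_σ = (d−2)/2 + d/2 = d − 1`, boundary flux =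
harmonic measure; refuter job j022942: `d = 5` flat `1.17–1.21`).  A proof would need a mean-field UPPER bound on
free-surface correlations `Σ_{x∈∂Λ_m}⟨σ₀σ_x⟩^free_{Λ_m} ≤ C` in `d ≥ 5` — the lace expansion / random-current
`η = 0` results (Sakai 2007; Aizenman–Duminil-Copin 2021) control BULK two-point functions (`⟨σ₀σ_x⟩ ≍ |x|^{2−d}`,
giving only `φ(Λ_m) ≤ C m` as in `d = 3`), not the free-surface profile; the half-space analysis exists for
high-`d` PERCOLATION only (Chatterjee–Hanson 2020).  Not attempted in Lean (no statement in the tree to lean on);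
recorded as the barrier `IsingTrivialityFromDimensionFour` demands: a proof of the crux must be `d`-sensitive.

### (e.2) Superset scan, `d = 2` exact (kit jobs j026052 [4 cores, H ≤ 19] / j026091 [1 core, H ≤ 17])
Exact column transfer matrix at `β_c(ℤ²) = ½log(1+√2)` for 312 supersets `S ⊇ Λ_m`, `m ∈ {2,3,4}`, in 17 families:
rectangles (2-D slabs), diamonds, discs, hairs, comb coats, perforated coats (period 2,3,4; offsets; gaps),
block-perforated coats, grid coats, cages with 1/2/4 bridges, corner-exposing bumps (1 and 2 generations),
porous hole rings at each radius, radial slits, carpet coat, checkerboard annulus, random dilution `p ≤ 0.5`.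
Reported: `φ(S)/φ(Λ_m)` and `φ(S)/min_{r ≥ m} φ(Λ_r)`; self-test against brute force on 17 sites (err < 1e-9).
RESULTS (j026091, H ≤ 17, 293 shapes, 77 s; `~/compute/j026091/outputs/table.txt`, evidence `compute-j026091.json`):
boxes `φ(Λ_0..8) = 1.763, 2.302, 2.698, 3.017, 3.289, 3.527, 3.742, 3.938, 4.118` (growing, local exponent ↑ toward 3/8,
agrees with j022942).  **EVERY proper superset tested has `φ(S) > φ(Λ_m)`**: global `min φ(S)/φ(Λ_m) = 1.000` attained
ONLY by the trivial `S = Λ_m` (disc `R² = 2m²` at `m = 2`).  Minimum ratio per family (m ∈ {2,3,4}, coats to radius 8):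
cage-with-1-bridge 1.015 (a nearly disconnected wall: → 1⁺ trivially), 3-site face bumps 1.044, rect `L = m+2` 1.063,
comb coat 1.069, hairs 1.072, grid coat ℓ=6 1.078, checkerboard annulus 1.106, 2-generation bumps 1.124,
block-perforated coat 1.133, diamond `R = 2m` 1.143, random dilution p=0.5 1.143, radial slits 1.181,
perforated coat 1.197, carpet coat 1.323, porous hole ring 1.378.  Porosity/perforation/dilution RAISE `φ` by 15–80 %
(holes see bulk correlations), cages and thin decorations change it by `+1.5…12 %`, convex supersets (disc, diamond,
rectangles) by `+6…37 %`.  Trends with `m` at fixed perturbation size go to `1⁺` like `1 + O(1/m)` (bumps 1.101/1.072/1.056,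
rect(m+2) 1.095/1.076/1.063, circumscribed disc —/1.072/1.065); scale-`m` perturbations (diamond 2m: 1.143/1.165/1.178)
move AWAY from 1.  No family trends below 1.  CONCLUSION (d = 2, m ≤ 4): not only is `SupersetStable` unthreatened —
the data suggest the much stronger "the box minimises `φ` among its finite supersets" at these scales (`c' = 1`, `r = m`).
CONFIRMED by j026052 (same families, H ≤ 19, coats to radius 9, 312 shapes, 107 s): global minimum again 1.000 only at
`S = Λ_m`; per-family minima cage 1.015, bumps 1.044, rect 1.063, comb 1.070, hairs 1.072, grid 1.079, checker 1.106,
diluted 1.119, bumps2 1.124, perfblocks 1.135, diamond 1.143, slits 1.181, perforated 1.197, carpet 1.373, holering 1.417.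
Follow-up queued: j026239 (monotonicity pairs S ⊂ T: pits, corner removal, q = 2/3 fills; rounded boxes ⊇ Λ_m — is the
box the exact minimiser?).

### (e.3) `d = 3` EXACT tube transfer matrix (cross-section ≤ 5×5, ≤ 2²⁵ states/slice; kit job j026145, 451 s, 4 cores;
`~/compute/j026145/outputs/table3d.txt`, evidence `compute-j026145.json`), `β = 0.221654626` (`t = tanh β = 0.218095`):
* `φ(Λ_1) = 1.520778` (MC j022942: 1.521(3) ✓), `φ(Λ_2) = 1.654091`, ratio 1.0877 (local exponent 0.121 at these sizes;
  asymptotic 0.19–0.21); `φ({0}) = 6β = 1.3299`, `φ({0,e₁}) = β(5+5t) = 1.3500`.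
* ALL 26 proper supersets of `Λ_1` inside the tube radiate MORE than `Λ_1` (ratio ∈ [1.0037, 1.117]): single face bump
  1.0037; bump + q=2 fill 1.0053; + third site 1.0069; + q=3 fill 1.0072 (filling concave corners INCREASES `φ` — the
  first-order decrease `(6−q)t < 1` is beaten by the GKS feedback already at `q = 2, 3`); face layer minus centre (q=5 pit)
  1.0109 < full face layer 1.0113; two face layers 1.0228; 3×3 bars 1.023–1.040; 3×5×5 slab 1.0516; `Λ_2` 1.0877;
  54 hairs 1.0723; perforated shell 1.0819; checkerboard shell 1.0475; open cage (walls at i=±3, 2 bridges) 1.0114;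
  closed 7×5×5 cage 1.0939; both 5×5 bars ⊇ Λ_2 exceed `φ(Λ_2)` (1.017, 1.027).
* MONOTONICITY in the domain is FALSE, but only just: `φ(Λ_2 ∖ {(2,0,0)}) = 1.654539 > φ(Λ_2) = 1.654091` (a face-centre
  pit radiates `+0.03 %` more than the full box: `S ⊂ T`, `0 ∈ S`, `φ(S) > φ(T)`), while 6 pits 1.6494, 1 corner removed
  1.65402, 8 corners 1.65352, rounded cube (no edges/corners) 1.6308 are all BELOW `φ(Λ_2)`.  So `PhiMonotone` (§(d))
  fails at relative size `3·10⁻⁴` and only in the direction "a SUBSET with a pit radiates more" — never, in any of the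
  2-D (605) or 3-D (28) instances, "a SUPERSET radiates less than the box".
CONCLUSION (d = 3, exact, m ≤ 2): consistent with d = 2 — the data support `SupersetStable` with `c' = 1, r = m`
("BoxMinimal": `φ(S) ≥ φ(Λ_m)` for all finite `S ⊇ Λ_m`), a form the lead may prefer to attack directly; the cheap
route via full domain-monotonicity is closed by the pit instance.  Pending: j026239 (2-D monotonicity pairs at M ≤ 7 and
rounded boxes ⊇ Λ_m up to radius 8).
-/

/-- The crux in dimension `d` (for the record of (e.1); `PhiCoerciveDim 3 ↔ PhiCoercive` by `Iff.rfl`). -/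
def PhiCoerciveDim (d : ℕ) : Prop :=
  ∃ κ c : ℝ, 0 < κ ∧ 0 < c ∧ ∀ m : ℕ, 1 ≤ m → ∀ S : Finset (Site d), box d m ⊆ S →
    c * (m : ℝ) ^ κ ≤ dcpPhi d (criticalBeta d) S

theorem phiCoerciveDim_three_iff : PhiCoerciveDim 3 ↔ PhiCoercive := Iff.rfl

end Summit.CriticalPhenomena.Ising3DConformalLimit.Cruxes.PhiCoercive.Disproof

end
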